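import Literature.AlgebraicGeometry.Motives.HodgeStructureIntegralLatticeKunneth
import HarnessLib

/-!
# The class of an integral operator is an integral class: Milne's dictionary `u ↦ ū` identifies `H•(X₁ × X₂, ℤ)` with the operators
# `T : H•(X₁) → H•(X₂)` such that `T(H•(X₁, ℤ)) ⊆ H•(X₂, ℤ)`; the Künneth projectors, `[Δ]`, the graph classes `⋀u`, the class of the
# Fourier transform and of every `γ ∈ SL₂(ℤ)` are integral classes (Milne 1999 §5; Voisin (11.11); Beauville 2010 §2, §4)

[topic AlgebraicGeometry/Motives]

Layer `Literature/AlgebraicGeometry/Motives` (namespace `Literature.AlgebraicGeometry.Motives.ExteriorLefschetz`), lane `lit-hodgefound`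
(Track 2 foundations library; prover seat `lit-hodgefound-p34`, generation 39, row g39-#10).  THEOREMS ONLY (no `def`, no named fact, no
instance, no notation; D-0026 net debt `0`).  The converse of row g39-#8 §3 (`HodgeStructureIntegralLatticeKunneth`:
`u ∈ L₁ ⊠ L₂ ⟹ ū(L₁) ⊆ L₂`), on the API of g32-#2 (`HodgeStructureExteriorAlgebraCorrespondences`: `corrMap ω₁ g₁ = (u ↦ ū)`,
`corrMap_kunnethEquiv_tmul_apply : Φ(a ⊗ c)~(x) = τ_{ω₁}(x ∧ a) · c`, `IsSymplectic.corrMap_injective`, `corrEquiv`), of g39-#2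
(`HodgeStructureIntegralLatticePoincareDuality`: `τ_θ(w_A ∧ w_{Aᶜ}) = ±1`, `τ_θ(w_A ∧ w_B) = 0` for `B ≠ Aᶜ`) and of g39-#1/#5
(`ℱ`, `SL₂(ℤ)`, `⋀u` preserve `L = H•(X, ℤ)`).

THE SETTING.  `K` a field of characteristic `0`; `bᵢ` Darboux bases of `Wᵢ = H¹(Xᵢ, K)` (genus `gᵢ`), `θᵢ = twoVector bᵢ` (principal
polarizations), `Lᵢ = L(bᵢ) = span_ℤ {w_A(bᵢ)} = H•(Xᵢ, ℤ)`, `L₁ ⊠ L₂ = span_ℤ {p^*w_A ∧ q^*w_B} = H•(X₁ × X₂, ℤ)` (g39-#8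
`span_weightBasis_prod_eq_kunnethSpan`); `ū = corrMap θ₁ g₁ u`, `ū(x) = q_*(p^*x ∧ u)`.

## Sources, VERBATIM

* J. S. Milne, *Lefschetz classes on abelian varieties*, Duke Math. J. **96** (1999) [Milne1999LefschetzClasses], §5 p. 664 (held text
  `paper:doi-10-1215-s0012-7094-99-09620-5`, p0026): "The map sending `u ∈ H^{2s}(X × Y)(s)` to the composite
  `H^*(X) —p^*→ H^*(X × Y) —(v ↦ v ∪ u)→ H^{*+2s}(X × Y)(s) —q_*→ H^{*+2s−2d}(Y)(s − d)`, `d = dim X`, is an isomorphism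
  `u ↦ ū : H^*(X × Y) → Hom(H^*(X), H^{*+2s−2d}(Y)(s − d))`."
* C. Voisin, *Hodge Theory and Complex Algebraic Geometry I* (2002) [VoisinHodgeI2002], §11.3.3 (11.11): "`α̃(η) = ⟨η, β⟩_X γ`" for a
  decomposable class `α = β ⊗ γ` (in the tree: `corrMap_kunnethEquiv_tmul_apply`).
* A. Beauville, *The action of SL₂ on abelian varieties* (2010) [Beauville2010SL2], §2 (2.3) "`ℱ(z) = d⁻¹(e^℘)_* z`" and §4 Theorem (the
  `SL₂`-action is by correspondences `φ(g) ∈ Corr(A)`: "`g·z = φ(g)_* z`").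
* N. Bourbaki, *Algebra I*, Ch. III §7 no. 7 Prop. 10 [BourbakiAlgebraI1989] (Künneth over `ℤ`, the content of g39-#8) and H. Lange,
  *Abelian Varieties over the Complex Numbers* (2023) [Lange2023AbelianVarietiesComplex], §1.1.3 Lemma 1.1.17 (`H•(X, ℤ) = ⋀H¹(X, ℤ)`).

## The proof

Milne's `u ↦ ū` is an isomorphism; we write down its inverse ON THE WEIGHT BASIS (§1): for a `K`-linear `T : ⋀W₁ → ⋀W₂`,
`u_T := Σ_A τ_{θ₁}(w_A ∧ w_{Aᶜ}) · p^*w_{Aᶜ} ∧ q^*T(w_A)` has `ū_T = T` — by Voisin's formula `ū_T(w_B) = Σ_A τ(w_A ∧ w_{Aᶜ})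
τ(w_B ∧ w_{Aᶜ}) T(w_A) = τ(w_B ∧ w_{Bᶜ})² T(w_B) = T(w_B)`, since `τ(w_B ∧ w_{Aᶜ}) = 0` unless `A = B` and `τ(w_B ∧ w_{Bᶜ}) = ±1`
(the integral Poincaré duality of g39-#2).  The coefficients `±1` are integers, so `u_T ∈ L₁ ⊠ L₂` as soon as every `T(w_A) ∈ L₂` (§2);
by injectivity of `u ↦ ū` this gives the criterion `u ∈ L₁ ⊠ L₂ ⟺ ū(L₁) ⊆ L₂`.  §3 lists the standard operators preserving `H•(X, ℤ)`.

## Contents (all proved)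

* §1 **`corrMap_sum_trace_smul_map_inl_compl_mul_map_inr`** (`ū_T = T`), `eq_sum_trace_smul_of_corrMap_eq` (`u = u_{ū}`).
* §2 **`mem_kunnethSpan_of_forall_corrMap_weightBasis_mem`**, **`mem_kunnethSpan_iff_forall_corrMap_mem`** (`u ∈ L₁ ⊠ L₂ ⟺ ū(L₁) ⊆ L₂`),
  `mem_span_weightBasis_prod_iff_forall_corrMap_mem` (the same for `L(b₁₂)`), `corrEquiv_symm_mem_kunnethSpan_iff`
  (`[T] ∈ H•(X₁ × X₂, ℤ) ⟺ T(H•(X₁, ℤ)) ⊆ H•(X₂, ℤ)`).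
* §3 on `X × X`: `proj_mem_span_weightBasis` (`H•(X, ℤ)` is graded), **`corrEquiv_symm_proj_mem_kunnethSpan`** (the KÜNNETH PROJECTORS
  `π_k` are integral classes), `corrEquiv_symm_id_mem_kunnethSpan` (`[Δ]`), `corrEquiv_symm_mul_twoVector_mem_kunnethSpan` (`[L_θ]`),
  `corrEquiv_symm_map_mem_kunnethSpan` (graph classes `[⋀u]`, `u(Λ) ⊆ Λ`), **`corrEquiv_symm_fourierTransform_mem_kunnethSpan`**
  (the class inducing `ℱ`), **`corrEquiv_symm_sl2Action_coe_mem_kunnethSpan`** (every `γ ∈ SL₂(ℤ)` acts by an integral class).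
-/

open scoped TensorProduct MatrixGroups

namespace Literature.AlgebraicGeometry.Motives

namespace ExteriorLefschetz

open ExteriorAlgebra Module

variable {K : Type*} [Field K] [CharZero K] {W₁ W₂ : Type*} [AddCommGroup W₁] [Module K W₁] [AddCommGroup W₂] [Module K W₂]
  {g₁ g₂ : ℕ} (b₁ : Basis (Fin g₁ ⊕ Fin g₁) K W₁) (b₂ : Basis (Fin g₂ ⊕ Fin g₂) K W₂)

/-! ## §1 The inverse dictionary on the weight basis: `u_T = Σ_A τ(w_A ∧ w_{Aᶜ}) · p^*w_{Aᶜ} ∧ q^*T(w_A)`, `ū_T = T` -/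

/-- **The inverse of Milne's `u ↦ ū` on the weight basis**: for any `K`-linear `T : ⋀W₁ → ⋀W₂`, the class
`u_T = Σ_A τ_{θ₁}(w_A ∧ w_{Aᶜ}) · p^*w_{Aᶜ} ∧ q^*T(w_A)` realises `T`: `ū_T(w_B) = Σ_A τ(w_A ∧ w_{Aᶜ}) τ(w_B ∧ w_{Aᶜ}) T(w_A) = T(w_B)`
("`α̃(η) = ⟨η, β⟩ γ`" and the duality `τ(w_B ∧ w_{Aᶜ}) = ±δ_{AB}`). [cite: Milne1999LefschetzClasses, §5 p. 664 ("is an isomorphism u ↦ ū")]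
[cite: VoisinHodgeI2002, §11.3.3 (11.11)] -/
theorem corrMap_sum_trace_smul_map_inl_compl_mul_map_inr (T : ExteriorAlgebra K W₁ →ₗ[K] ExteriorAlgebra K W₂) :
    corrMap (twoVector b₁) g₁ (∑ A : Finset (Fin g₁ ×ₗ Bool), trace (twoVector b₁) g₁ (weightBasis b₁ A * weightBasis b₁ Aᶜ) •
        (ExteriorAlgebra.map (LinearMap.inl K W₁ W₂) (weightBasis b₁ Aᶜ) *
          ExteriorAlgebra.map (LinearMap.inr K W₁ W₂) (T (weightBasis b₁ A)))) = T := by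
  refine (weightBasis b₁).ext fun B ↦ ?_
  rw [map_sum, LinearMap.sum_apply,
    Finset.sum_eq_single B (fun A _ hAB ↦ ?_) (fun h ↦ absurd (Finset.mem_univ B) h)]
  · rw [map_smul, LinearMap.smul_apply, ← kunnethEquiv_tmul, corrMap_kunnethEquiv_tmul_apply, smul_smul]
    obtain ⟨n, hn⟩ := exists_trace_weightBasis_mul_weightBasis_compl b₁ B
    rw [hn, ← pow_add, ← two_mul, pow_mul, neg_one_sq, one_pow, one_smul]
  · rw [map_smul, LinearMap.smul_apply, ← kunnethEquiv_tmul, corrMap_kunnethEquiv_tmul_apply,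
      trace_weightBasis_mul_weightBasis_of_ne_compl b₁ (fun h ↦ hAB (compl_injective h)), zero_smul, smul_zero]

/-- Hence **every class is the weight-basis expansion of its operator**: `u = Σ_A τ(w_A ∧ w_{Aᶜ}) · p^*w_{Aᶜ} ∧ q^*ū(w_A)`
(`u ↦ ū` is injective). [cite: Milne1999LefschetzClasses, §5 p. 664 ("The map u ↦ ū is bijective")] -/
theorem eq_sum_trace_smul_of_corrMap_eq {u : ExteriorAlgebra K (W₁ × W₂)} {T : ExteriorAlgebra K W₁ →ₗ[K] ExteriorAlgebra K W₂}
    (hu : corrMap (twoVector b₁) g₁ u = T) :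
    u = ∑ A : Finset (Fin g₁ ×ₗ Bool), trace (twoVector b₁) g₁ (weightBasis b₁ A * weightBasis b₁ Aᶜ) •
        (ExteriorAlgebra.map (LinearMap.inl K W₁ W₂) (weightBasis b₁ Aᶜ) *
          ExteriorAlgebra.map (LinearMap.inr K W₁ W₂) (T (weightBasis b₁ A))) :=
  (isSymplectic_twoVector b₁).corrMap_injective (W₂ := W₂)
    (by rw [hu, corrMap_sum_trace_smul_map_inl_compl_mul_map_inr])

/-! ## §2 `u ∈ H•(X₁ × X₂, ℤ) ⟺ ū(H•(X₁, ℤ)) ⊆ H•(X₂, ℤ)` -/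

/-- **If `ū(w_A) ∈ H•(X₂, ℤ)` for every weight-basis vector `w_A` of `X₁`, then `u ∈ L₁ ⊠ L₂ = H•(X₁ × X₂, ℤ)`** (the expansion of §1
has coefficients `τ(w_A ∧ w_{Aᶜ}) = ±1 ∈ ℤ`). [cite: Milne1999LefschetzClasses, §5 p. 664] [cite: Lange2023AbelianVarietiesComplex,
§1.1.3 Lemma 1.1.17] -/
theorem mem_kunnethSpan_of_forall_corrMap_weightBasis_mem {u : ExteriorAlgebra K (W₁ × W₂)}
    (hu : ∀ A : Finset (Fin g₁ ×ₗ Bool), corrMap (twoVector b₁) g₁ u (weightBasis b₁ A) ∈ Submodule.span ℤ (Set.range (weightBasis b₂))) :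
    u ∈ Submodule.span ℤ (Set.image2 (fun x y ↦ ExteriorAlgebra.map (LinearMap.inl K W₁ W₂) x * ExteriorAlgebra.map (LinearMap.inr K W₁ W₂) y)
        (Set.range (weightBasis b₁)) (Set.range (weightBasis b₂))) := by
  rw [eq_sum_trace_smul_of_corrMap_eq b₁ (u := u) rfl]
  refine Submodule.sum_mem _ fun A _ ↦ ?_
  obtain ⟨n, hn⟩ := exists_trace_weightBasis_mul_weightBasis_compl b₁ A
  rw [hn, show ((-1 : K) ^ n) = (((-1 : ℤ) ^ n : ℤ) : K) by rw [Int.cast_pow, Int.cast_neg, Int.cast_one], Int.cast_smul_eq_zsmul]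
  exact Submodule.smul_mem _ _
    (map_inl_mul_map_inr_mem_kunnethSpan b₁ b₂ (Submodule.subset_span ⟨Aᶜ, rfl⟩) (hu A))

/-- **CRITERION: `u ∈ H•(X₁ × X₂, ℤ) ⟺ ū(H•(X₁, ℤ)) ⊆ H•(X₂, ℤ)`** (`⟹` is g39-#8 `corrMap_mem_span_weightBasis`): under Milne's
isomorphism `u ↦ ū` the integral classes are exactly the operators preserving the integral lattices. [cite: Milne1999LefschetzClasses,
§5 p. 664 (u ↦ ū)] [cite: BourbakiAlgebraI1989, Ch. III §7 no. 7 Prop. 10] -/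
theorem mem_kunnethSpan_iff_forall_corrMap_mem {u : ExteriorAlgebra K (W₁ × W₂)} :
    u ∈ Submodule.span ℤ (Set.image2 (fun x y ↦ ExteriorAlgebra.map (LinearMap.inl K W₁ W₂) x * ExteriorAlgebra.map (LinearMap.inr K W₁ W₂) y)
        (Set.range (weightBasis b₁)) (Set.range (weightBasis b₂))) ↔
      ∀ x ∈ Submodule.span ℤ (Set.range (weightBasis b₁)),
        corrMap (twoVector b₁) g₁ u x ∈ Submodule.span ℤ (Set.range (weightBasis b₂)) :=
  ⟨fun hu _ hx ↦ corrMap_mem_span_weightBasis b₁ b₂ hu hx,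
    fun h ↦ mem_kunnethSpan_of_forall_corrMap_weightBasis_mem b₁ b₂ fun A ↦ h _ (Submodule.subset_span ⟨A, rfl⟩)⟩

/-- The same criterion for the lattice `L(b₁₂)` of the concatenated Darboux basis of `W₁ × W₂` (g39-#8
`span_weightBasis_prod_eq_kunnethSpan`). [cite: Milne1999LefschetzClasses, §5 p. 664] [cite: BourbakiAlgebraI1989, Ch. III §7 no. 7 Prop. 10] -/
theorem mem_span_weightBasis_prod_iff_forall_corrMap_mem {u : ExteriorAlgebra K (W₁ × W₂)} :
    u ∈ Submodule.span ℤ (Set.range (weightBasis ((b₁.prod b₂).reindex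
      ((Equiv.sumSumSumComm (Fin g₁) (Fin g₁) (Fin g₂) (Fin g₂)).trans (Equiv.sumCongr finSumFinEquiv finSumFinEquiv))))) ↔
      ∀ x ∈ Submodule.span ℤ (Set.range (weightBasis b₁)),
        corrMap (twoVector b₁) g₁ u x ∈ Submodule.span ℤ (Set.range (weightBasis b₂)) := by
  rw [span_weightBasis_prod_eq_kunnethSpan, mem_kunnethSpan_iff_forall_corrMap_mem]

/-- **`[T] ∈ H•(X₁ × X₂, ℤ) ⟺ T(H•(X₁, ℤ)) ⊆ H•(X₂, ℤ)`** for the class `[T] = corrEquiv⁻¹ T` of an operator `T : ⋀W₁ → ⋀W₂`.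
[cite: Milne1999LefschetzClasses, §5 p. 664 ("is an isomorphism u ↦ ū")] -/
theorem corrEquiv_symm_mem_kunnethSpan_iff (T : ExteriorAlgebra K W₁ →ₗ[K] ExteriorAlgebra K W₂) :
    (isSymplectic_twoVector b₁).corrEquiv.symm T ∈
        Submodule.span ℤ (Set.image2 (fun x y ↦ ExteriorAlgebra.map (LinearMap.inl K W₁ W₂) x * ExteriorAlgebra.map (LinearMap.inr K W₁ W₂) y)
          (Set.range (weightBasis b₁)) (Set.range (weightBasis b₂))) ↔
      ∀ x ∈ Submodule.span ℤ (Set.range (weightBasis b₁)), T x ∈ Submodule.span ℤ (Set.range (weightBasis b₂)) := by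
  rw [mem_kunnethSpan_iff_forall_corrMap_mem, ← (isSymplectic_twoVector b₁).corrEquiv_apply, LinearEquiv.apply_symm_apply]

/-! ## §3 Integral classes of the standard operators on `X × X` -/

section Self

variable {W : Type*} [AddCommGroup W] [Module K W] {g : ℕ} (b : Basis (Fin g ⊕ Fin g) K W)

omit [CharZero K] in
/-- **`H•(X, ℤ)` is a graded lattice**: the homogeneous components of an integral class are integral (`π_k w_A = w_A` or `0`).
[cite: Lange2023AbelianVarietiesComplex, §1.1.3 Lemma 1.1.17 and Exercise 1.1.6 (7) (H^k(X, ℤ) = ⋀^k H¹(X, ℤ))] -/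
theorem proj_mem_span_weightBasis (k : ℕ) {x : ExteriorAlgebra K W} (hx : x ∈ Submodule.span ℤ (Set.range (weightBasis b))) :
    GradedAlgebra.proj (fun m : ℕ ↦ ⋀[K]^m W) k x ∈ Submodule.span ℤ (Set.range (weightBasis b)) := by
  induction hx using Submodule.span_induction with
  | mem y hy =>
    obtain ⟨A, rfl⟩ := hy
    rw [GradedAlgebra.proj_apply]
    by_cases hk : A.card = k
    · subst hk
      rw [DirectSum.decompose_of_mem_same (fun m : ℕ ↦ ⋀[K]^m W) (weightBasis_mem b A)]
      exact Submodule.subset_span ⟨A, rfl⟩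
    · rw [DirectSum.decompose_of_mem_ne (fun m : ℕ ↦ ⋀[K]^m W) (weightBasis_mem b A) hk]
      exact Submodule.zero_mem _
  | zero => rw [map_zero]; exact Submodule.zero_mem _
  | add y z _ _ hy hz => rw [map_add]; exact Submodule.add_mem _ hy hz
  | smul n y _ hy => rw [map_zsmul]; exact Submodule.smul_mem _ n hy

/-- **The Künneth projectors are integral classes**: `[π_k] ∈ H•(X × X, ℤ)` (`π_k = ` the projection of `⋀W` onto `⋀ᵏW`; for an
abelian variety the Künneth components of the diagonal are integral — and algebraic — classes). [cite: Milne1999LefschetzClasses, §5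
p. 664 (u ↦ ū) and Thm. 5.9 (p. 665)] [cite: Lange2023AbelianVarietiesComplex, §1.1.3 Lemma 1.1.17] -/
theorem corrEquiv_symm_proj_mem_kunnethSpan (k : ℕ) :
    (isSymplectic_twoVector b).corrEquiv.symm (GradedAlgebra.proj (fun m : ℕ ↦ ⋀[K]^m W) k) ∈
      Submodule.span ℤ (Set.image2 (fun x y ↦ ExteriorAlgebra.map (LinearMap.inl K W W) x * ExteriorAlgebra.map (LinearMap.inr K W W) y)
        (Set.range (weightBasis b)) (Set.range (weightBasis b))) :=
  (corrEquiv_symm_mem_kunnethSpan_iff b b _).2 fun _ hx ↦ proj_mem_span_weightBasis b k hx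

/-- **The class of the diagonal is integral**: `[Δ] = [id] ∈ H•(X × X, ℤ)`. [cite: Milne1999LefschetzClasses, §5 p. 664] -/
theorem corrEquiv_symm_id_mem_kunnethSpan :
    (isSymplectic_twoVector b).corrEquiv.symm (LinearMap.id : ExteriorAlgebra K W →ₗ[K] ExteriorAlgebra K W) ∈
      Submodule.span ℤ (Set.image2 (fun x y ↦ ExteriorAlgebra.map (LinearMap.inl K W W) x * ExteriorAlgebra.map (LinearMap.inr K W W) y)
        (Set.range (weightBasis b)) (Set.range (weightBasis b))) :=
  (corrEquiv_symm_mem_kunnethSpan_iff b b _).2 fun _ hx ↦ hx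

/-- **The class of the Lefschetz operator `L_θ = θ ∧ ·` is integral** (`θ ∈ H²(X, ℤ)` and `H•(X, ℤ)` is a ring).
[cite: Milne1999LefschetzClasses, §5 p. 664 and Thm. 5.9] [cite: Lange2023AbelianVarietiesComplex, §1.1.3 Lemma 1.1.17] -/
theorem corrEquiv_symm_mul_twoVector_mem_kunnethSpan :
    (isSymplectic_twoVector b).corrEquiv.symm (LinearMap.mul K (ExteriorAlgebra K W) (twoVector b)) ∈
      Submodule.span ℤ (Set.image2 (fun x y ↦ ExteriorAlgebra.map (LinearMap.inl K W W) x * ExteriorAlgebra.map (LinearMap.inr K W W) y)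
        (Set.range (weightBasis b)) (Set.range (weightBasis b))) := by
  refine (corrEquiv_symm_mem_kunnethSpan_iff b b _).2 fun x hx ↦ ?_
  rw [LinearMap.mul_apply']
  have h1 := inv_factorial_smul_twoVector_pow_mem_span_weightBasis b 1
  rw [Nat.factorial_one, Nat.cast_one, inv_one, one_smul, pow_one] at h1
  exact mul_mem_span_weightBasis b h1 hx

omit [CharZero K] in
/-- **Graph classes are integral**: for `u ∈ End_K(W)` with `u(Λ) ⊆ Λ` (`Λ = H¹(X, ℤ)`), the class of `⋀u = u^*` is integral
(g39-#5 `map_mem_span_weightBasis`). [cite: Milne1999LefschetzClasses, §5 p. 664 and proof of Prop. 5.4 (p. 663, graph of a homomorphism)]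
[cite: Lange2023AbelianVarietiesComplex, §1.1.3 Lemma 1.1.17 (a)] -/
theorem corrEquiv_symm_map_mem_kunnethSpan [CharZero K] (u : W →ₗ[K] W) (hu : ∀ i, u (b i) ∈ Submodule.span ℤ (Set.range b)) :
    (isSymplectic_twoVector b).corrEquiv.symm (ExteriorAlgebra.map u).toLinearMap ∈
      Submodule.span ℤ (Set.image2 (fun x y ↦ ExteriorAlgebra.map (LinearMap.inl K W W) x * ExteriorAlgebra.map (LinearMap.inr K W W) y)
        (Set.range (weightBasis b)) (Set.range (weightBasis b))) :=
  (corrEquiv_symm_mem_kunnethSpan_iff b b _).2 fun _ hx ↦ map_mem_span_weightBasis b u hu hx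

/-- **The class inducing the Fourier transform is integral**: `[ℱ] ∈ H•(X × X, ℤ)` for a principally polarized `X` of dimension
`g ≥ 1` — Beauville's "`ℱ(z) = d⁻¹ (e^℘)_* z`" with `d = 1`, `e^℘ = ch(P)` the Chern character of the Poincaré bundle; in the model from
g39-#1 `fourierTransform_mem_span_weightBasis` (`ℱ(w_A) = ± w_{A'}`). [cite: Beauville2010SL2, §2 (2.3) and §4 Theorem ("(0 −1 ; 1 0)·z = ℱ(z)")]
[cite: Milne1999LefschetzClasses, §5 p. 664 (u ↦ ū)] -/
theorem corrEquiv_symm_fourierTransform_mem_kunnethSpan (hg : 0 < g) :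
    (isSymplectic_twoVector b).corrEquiv.symm (fourierTransform (twoVector b) g) ∈
      Submodule.span ℤ (Set.image2 (fun x y ↦ ExteriorAlgebra.map (LinearMap.inl K W W) x * ExteriorAlgebra.map (LinearMap.inr K W W) y)
        (Set.range (weightBasis b)) (Set.range (weightBasis b))) :=
  (corrEquiv_symm_mem_kunnethSpan_iff b b _).2 fun _ hx ↦ fourierTransform_mem_span_weightBasis b hg hx

/-- **Every `γ ∈ SL₂(ℤ)` acts on `H•(X)` through an INTEGRAL correspondence class** (`X` principally polarized, `g ≥ 1`): the class of
Beauville's `φ(γ)` lies in `H•(X × X, ℤ)` (g39-#1 `sl2Action_coe_mem_span_weightBasis`). [cite: Beauville2010SL2, §4 Theorem ("g·z = φ(g)_* z")]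
[cite: Milne1999LefschetzClasses, §5 p. 664 (u ↦ ū)] -/
theorem corrEquiv_symm_sl2Action_coe_mem_kunnethSpan (hg : 0 < g) (γ : SL(2, ℤ)) :
    (isSymplectic_twoVector b).corrEquiv.symm (sl2Action (twoVector b) g (γ : SL(2, K))) ∈
      Submodule.span ℤ (Set.image2 (fun x y ↦ ExteriorAlgebra.map (LinearMap.inl K W W) x * ExteriorAlgebra.map (LinearMap.inr K W W) y)
        (Set.range (weightBasis b)) (Set.range (weightBasis b))) :=
  (corrEquiv_symm_mem_kunnethSpan_iff b b _).2 fun _ hx ↦ sl2Action_coe_mem_span_weightBasis b hg γ hx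

end Self

end ExteriorLefschetz

end Literature.AlgebraicGeometry.Motives
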